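import Literature.NumberTheory.EllipticCurves.EisensteinValuesAtRhoSix
import Literature.NumberTheory.EllipticCurves.ComplexMultiplicationSingularModuliNonmaximal
import HarnessLib

/-!
# Eisenstein series at the CM points of `ℚ(√−7)`: `E₆(ω₋₇) > 1`, `E₆(ω₋₂₈) > 1/2`; the lattices
# `Λ₋₇ = ℤ[(−7+√−7)/2]` and `Λ₋₂₈ = ℤ[√−7]` have `g₃ > 0`; the TYPE of a CM lattice `Ω·Λ_d`

Topic `Literature/NumberTheory/EllipticCurves` (the modular-forms / complex-lattice cluster); companion
of `EisensteinValuesAtRhoSix.lean` (`E₆(ρ) > 1`, `g₃(ℤρ + ℤ) > 0`) for the two CM points of the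
imaginary quadratic field `ℚ(√−7)`: `τ = ω₋₇ = (−7 + i√7)/2` (maximal order, `j = −3375`,
`Literature.NumberTheory.EllipticCurves.j_cmPeriodPair_neg_seven`) and `τ = ω₋₂₈ = −14 + i√28/2`
(order `ℤ[√−7]` of conductor `2`, `j = 16581375 = 255³`,
`Literature.NumberTheory.EllipticCurves.j_cmPeriodPair_neg_twentyeight`).  THEOREMS ONLY (no
definition, no named fact, no `sorry`):

* `ModularForms.cexp_two_pi_I_cmTau_neg_seven`, `…_neg_twentyeight`: the nomes
  `e^{2πiω₋₇} = −e^{−π√7}`, `e^{2πiω₋₂₈} = +e^{−π√28}`;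
* `ModularForms.E₆_cmTau_neg_seven_eq_ofReal` (`E₆(ω₋₇)` is real and `> 1`),
  `ModularForms.E₆_cmTau_neg_twentyeight_eq_ofReal` (`E₆(ω₋₂₈)` is real and `> 1/2`) — from
  Mathlib's `q`-expansion `EisensteinSeries.q_expansion_bernoulli`
  (`E₆ = 1 − 504 ∑_{n≥1} σ₅(n) qⁿ`) with `σ₅(n) ≤ 2·8ⁿ` (`ModularForms.sigma_five_le`) and the
  geometric tail `|∑_{n≥2} σ₅(n)qⁿ| ≤ 128x²/(1 − 8x) < x`, `x = |q| < 1/136` (resp. `< 1/2016`),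
  exactly as in `ModularForms.E₆_rho_eq_ofReal`;
* `g₃_cmPeriodPair_neg_seven_eq_ofReal`, `g₃_cmPeriodPair_neg_twentyeight_eq_ofReal`:
  **`g₃(Λ₋₇) > 0`, `g₃(Λ₋₂₈) > 0`** (real) via `PeriodPair.g₃_ofUpperHalfPlane`
  (`g₃(Λ_τ) = (8π⁶/27)E₆(τ)`); `g₂(Λ₋₇) ≠ 0`, `g₂(Λ₋₂₈) ≠ 0` from the singular moduli
  (`j ≠ 0`); `isReal_cmPeriodPair` (`Λ_d` is conjugation-stable, `ω̄_d = d − ω_d`);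
* `exists_sq_eq_ofReal_of_lattice_eq_mulLeft` — **the lattice-type law**: if the Néron lattice `L`
  of a Weierstrass model `W/ℚ` (`IsNeronLatticeOf (W.baseChange ℂ) L`) is `Ω · Λ` for a real lattice
  `Λ` with `g₃(Λ) > 0` and `g₂(Λ) ≠ 0`, then `Ω² = t ∈ ℝ`, `t ≠ 0`, and **`t > 0 ↔ c₆(W) > 0`**
  (`c₄/12 = Ω⁻⁴g₂(Λ)`, `c₆/216 = Ω⁻⁶g₃(Λ)`, so `Ω² = (c₄ g₃(Λ))·18/(c₆ g₂(Λ)) ∈ ℝ` and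
  `Ω⁻⁶ = (Ω²)⁻³` has the sign of `c₆`): the generator `Ω` of a CM Néron lattice over `ℚ` is REAL
  (`Λ_E = Ω𝓞`) or PURELY IMAGINARY (`Λ_E = iΩ'𝓞`) according to the sign of `c₆`;
* `exists_lattice_eq_mulLeft_cmPeriodPair_of_j_eq_neg_3375`, `…_of_j_eq_16581375`: the Néron
  lattice of a model over `ℚ` with `j = −3375` (resp. `255³`) is `Ω · Λ₋₇` (resp. `Ω · Λ₋₂₈`),
  `Ω ≠ 0` (Cox Thm. 10.9 `PeriodPair.exists_lattice_eq_mulLeft_of_j_eq` + the proved rows of the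
  table of singular moduli), with the type law specialised:
  `exists_cm_generator_of_j_eq_neg_3375`, `exists_cm_generator_of_j_eq_16581375`.

Use (cell `bsd-cm`, crux `EllipticUnitValueSevenOfGZK`, stub (S-P) `stub_latticeTypeLawSeven`): the
`𝒞₇` lattice-type law «imaginary type ⟺ `c₆ < 0`» for the partner `W₂` (`j = −3375`) and the
member `W` (`j ∈ {−3375, 255³}`).  Numerically `E₆(ω₋₇) = 1.12277…`, `g₃(Λ₋₇) = 319.83…`,
`E₆(ω₋₂₈) = 1.00003…`; for `49a1 = ⟨1,−1,0,−2,−1⟩` (`c₆ = 1323 > 0`) the lattice is `Ω·Λ₋₇` with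
`Ω = 1.93331…` real (Gross, Coates–Li–Tian–Zhai «𝔏 = Ω_∞𝒪»), which this file PROVES in the form
`0 < Ω²`.

## References

* J.-P. Serre, *A Course in Arithmetic*, GTM 7, VII §4.1–4.2 (`E₆ = 1 − 504∑σ₅(n)qⁿ`). [Serre1973]
* J. H. Silverman, *The Arithmetic of Elliptic Curves*, 2nd ed. (2009), VI.5.1, C.12. [SilvermanAEC2009]
* D. A. Cox, *Primes of the form x² + ny²*, 2nd ed. (2013), Thm. 10.9, §12.C table (12.20). [Cox2013]
* J. Coates, Y. Li, Y. Tian, S. Zhai, *Quadratic twists of elliptic curves*, Proc. LMS 110 (2015),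
  §2 («𝔏 = Ω_∞𝒪» for `X₀(49)`). [CoatesLiTianZhai2015]
-/

noncomputable section

open UpperHalfPlane hiding I
open Complex EisensteinSeries ModularForm PeriodPair
open scoped Real ArithmeticFunction.sigma ComplexConjugate

namespace Literature.NumberTheory.EllipticCurves

/-! ### The nomes at `ω₋₇` and `ω₋₂₈` -/

namespace ModularForms

/-- `ω₋₇ = (−7 + i√7)/2` as a complex number. [folklore] -/
private theorem coe_cmTau_neg_seven :
    ((cmTau (-7) : ℍ) : ℂ) = ((-(7 : ℝ) / 2 : ℝ) : ℂ) + ((Real.sqrt 7 / 2 : ℝ) : ℂ) * Complex.I := by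
  rw [coe_cmTau (by norm_num : (-7 : ℤ) < 0)]
  apply Complex.ext
  · norm_num [cmGen_re]
  · norm_num [cmGen_im]

/-- `ω₋₂₈ = −14 + i√28/2` as a complex number. [folklore] -/
private theorem coe_cmTau_neg_twentyeight :
    ((cmTau (-28) : ℍ) : ℂ) = ((-(14 : ℝ) : ℝ) : ℂ) + ((Real.sqrt 28 / 2 : ℝ) : ℂ) * Complex.I := by
  rw [coe_cmTau (by norm_num : (-28 : ℤ) < 0)]
  apply Complex.ext
  · norm_num [cmGen_re]
  · norm_num [cmGen_im]

/-- **The nome at `ω₋₇`**: `e^{2πiω₋₇} = −e^{−π√7}` (`2πiω₋₇ = −π√7 − 7πi`, `e^{−7πi} = −1`).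
[cite: Serre1973, VII §4.1 (the variable `q = e^{2πiz}`)] -/
theorem cexp_two_pi_I_cmTau_neg_seven :
    cexp (2 * π * Complex.I * (cmTau (-7) : ℍ)) =
      ((-Real.exp (-(π * Real.sqrt 7)) : ℝ) : ℂ) := by
  have harg : 2 * (π : ℂ) * Complex.I * (cmTau (-7) : ℍ) =
      ((-(π * Real.sqrt 7) : ℝ) : ℂ) + (((-4 : ℤ) : ℂ) * (2 * π * Complex.I) + (π : ℂ) * Complex.I) := by
    rw [coe_cmTau_neg_seven]
    apply Complex.ext
    · simp [Complex.mul_re, Complex.mul_im, Complex.add_re, Complex.add_im]; ring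
    · simp [Complex.mul_re, Complex.mul_im, Complex.add_re, Complex.add_im]; ring
  rw [harg, Complex.exp_add, Complex.exp_add, Complex.exp_int_mul_two_pi_mul_I, ← Complex.ofReal_exp,
    Complex.exp_pi_mul_I]
  push_cast
  ring

/-- **The nome at `ω₋₂₈`**: `e^{2πiω₋₂₈} = e^{−π√28}` (`2πiω₋₂₈ = −π√28 − 28πi`, `e^{−28πi} = 1`).
[cite: Serre1973, VII §4.1 (the variable `q = e^{2πiz}`)] -/
theorem cexp_two_pi_I_cmTau_neg_twentyeight :
    cexp (2 * π * Complex.I * (cmTau (-28) : ℍ)) =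
      ((Real.exp (-(π * Real.sqrt 28)) : ℝ) : ℂ) := by
  have harg : 2 * (π : ℂ) * Complex.I * (cmTau (-28) : ℍ) =
      ((-(π * Real.sqrt 28) : ℝ) : ℂ) + ((-14 : ℤ) : ℂ) * (2 * π * Complex.I) := by
    rw [coe_cmTau_neg_twentyeight]
    apply Complex.ext
    · simp [Complex.mul_re, Complex.mul_im, Complex.add_re, Complex.add_im]; ring
    · simp [Complex.mul_re, Complex.mul_im, Complex.add_re, Complex.add_im]; ring
  rw [harg, Complex.exp_add, Complex.exp_int_mul_two_pi_mul_I, ← Complex.ofReal_exp]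
  push_cast
  ring

/-- `e^{−π√7} < 1/136` (`√3 ≤ √7` and `e^{−π√3} < 1/136`, `exp_neg_pi_sqrt_three_lt`). [folklore] -/
private theorem exp_neg_pi_sqrt_seven_lt : Real.exp (-(π * Real.sqrt 7)) < 1 / 136 := by
  refine lt_of_le_of_lt ?_ exp_neg_pi_sqrt_three_lt
  rw [Real.exp_le_exp, neg_le_neg_iff]
  exact mul_le_mul_of_nonneg_left (Real.sqrt_le_sqrt (by norm_num)) Real.pi_pos.le

/-- `e^{−π√28} < 1/2016` (`π√28 > 3·5 = 15 ≥ 8` and `e⁸ > 2016`). [folklore] -/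
private theorem exp_neg_pi_sqrt_twentyeight_lt : Real.exp (-(π * Real.sqrt 28)) < 1 / 2016 := by
  have h5 : (5 : ℝ) < Real.sqrt 28 := by
    rw [Real.lt_sqrt (by norm_num)]; norm_num
  have h8 : (8 : ℝ) < π * Real.sqrt 28 := by
    have := Real.pi_gt_three
    nlinarith
  have he : (2016 : ℝ) < Real.exp 8 := by
    have h1 : (2.7182818283 : ℝ) < Real.exp 1 := Real.exp_one_gt_d9
    have : Real.exp 8 = Real.exp 1 ^ 8 := by
      rw [← Real.exp_nat_mul]; norm_num
    rw [this]
    have h0 : (0 : ℝ) ≤ 2.7182818283 := by norm_num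
    have := pow_lt_pow_left₀ h1 h0 (by norm_num : (8 : ℕ) ≠ 0)
    refine lt_trans ?_ this
    norm_num
  have h2016 : (2016 : ℝ) < Real.exp (π * Real.sqrt 28) :=
    he.trans (Real.exp_lt_exp.mpr h8)
  rw [Real.exp_neg, ← one_div]
  exact one_div_lt_one_div_of_lt (by norm_num) h2016

/-- **`E₆(ω₋₇)` is real and `> 1`**: with the nome `q = −x`, `x = e^{−π√7} < 1/136`,
`E₆(ω₋₇) = 1 − 504∑_{n≥1} σ₅(n)qⁿ = 1 + 504x − 504∑_{n≥2}σ₅(n)qⁿ` and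
`|∑_{n≥2} σ₅(n)qⁿ| ≤ ∑_{n≥2} 2(8x)ⁿ = 128x²/(1 − 8x) < x` (verbatim the argument of
`E₆_rho_eq_ofReal`). [cite: Serre1973, VII §4.2 (E₆ = 1 − 504 Σ σ₅(n) qⁿ)] -/
theorem E₆_cmTau_neg_seven_eq_ofReal :
    ∃ r : ℝ, 1 < r ∧ (E₆ (cmTau (-7)) : ℂ) = (r : ℂ) := by
  have h := EisensteinSeries.q_expansion_bernoulli (by norm_num : 3 ≤ 6) (by decide) (cmTau (-7))
  have hb : bernoulli 6 = 1 / 42 := by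
    rw [bernoulli_eq_bernoulli'_of_ne_one (by norm_num), PeriodPair.bernoulli'_six]
  simp_rw [zpow_natCast] at h
  rw [cexp_two_pi_I_cmTau_neg_seven, hb] at h
  set x : ℝ := Real.exp (-(π * Real.sqrt 7)) with hxdef
  have hx0 : 0 < x := Real.exp_pos _
  have hx : x < 1 / 136 := exp_neg_pi_sqrt_seven_lt
  have h8x : 8 * x < 1 := by linarith
  have h8x0 : 0 ≤ 8 * x := by linarith
  set S : ℝ := ∑' n : ℕ+, (σ 5 n : ℝ) * (-x) ^ (n : ℕ) with hSdef
  refine ⟨1 - 504 * S, ?_, ?_⟩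
  · suffices hS0 : S < 0 by linarith
    set g : ℕ → ℝ := fun m => (σ 5 (m + 1) : ℝ) * (-x) ^ (m + 1) with hgdef
    have hS : S = ∑' m : ℕ, g m :=
      tsum_pnat_eq_tsum_succ (f := fun n : ℕ => (σ 5 n : ℝ) * (-x) ^ n)
    have hbound : ∀ m, ‖g m‖ ≤ 2 * (8 * x) ^ (m + 1) := by
      intro m
      rw [hgdef, Real.norm_eq_abs, abs_mul, abs_pow, abs_neg, abs_of_pos hx0, Nat.abs_cast]
      calc (σ 5 (m + 1) : ℝ) * x ^ (m + 1) ≤ 2 * 8 ^ (m + 1) * x ^ (m + 1) := by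
            gcongr; exact sigma_five_le _
        _ = 2 * (8 * x) ^ (m + 1) := by rw [mul_pow]; ring
    have hgeom : Summable (fun m : ℕ => 2 * (8 * x) ^ (m + 1)) := by
      have := (summable_geometric_of_lt_one h8x0 h8x).mul_left (2 * (8 * x))
      refine this.congr (fun m => ?_)
      ring
    have hsum : Summable g := Summable.of_norm_bounded hgeom hbound
    have hsplit := hsum.tsum_eq_zero_add
    have hg0 : g 0 = -x := by
      simp [hgdef, ArithmeticFunction.sigma_apply, Nat.divisors_one]
    have htail_sum : Summable (fun m => g (m + 1)) := (summable_nat_add_iff 1).mpr hsum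
    have hgeom2 : Summable (fun m : ℕ => 2 * (8 * x) ^ (m + 2)) := by
      have := (summable_geometric_of_lt_one h8x0 h8x).mul_left (2 * (8 * x) ^ 2)
      refine this.congr (fun m => ?_)
      ring
    have htail_le : ∑' m, g (m + 1) ≤ ∑' m : ℕ, 2 * (8 * x) ^ (m + 2) := by
      refine Summable.tsum_le_tsum (fun m => ?_) htail_sum hgeom2
      exact (le_abs_self _).trans (by simpa [Real.norm_eq_abs] using hbound (m + 1))
    have hgeom_val : ∑' m : ℕ, 2 * (8 * x) ^ (m + 2) = 2 * (8 * x) ^ 2 / (1 - 8 * x) := by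
      rw [show (fun m : ℕ => 2 * (8 * x) ^ (m + 2)) = fun m => (2 * (8 * x) ^ 2) * (8 * x) ^ m by
        funext m; ring]
      rw [tsum_mul_left, tsum_geometric_of_lt_one h8x0 h8x]
      field_simp
    have hSx : S = -x + ∑' m, g (m + 1) := by rw [hS, hsplit, hg0]
    rw [hSx]
    have h1 : 2 * (8 * x) ^ 2 / (1 - 8 * x) < x := by
      rw [div_lt_iff₀ (by linarith)]
      nlinarith
    linarith
  · rw [show (E₆ (cmTau (-7)) : ℂ) = E (by norm_num : 3 ≤ 6) (cmTau (-7)) from rfl, h,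
      hSdef, Complex.ofReal_sub, Complex.ofReal_mul, Complex.ofReal_tsum]
    push_cast
    ring

/-- **`E₆(ω₋₂₈)` is real and `> 1/2`**: with the POSITIVE nome `q = x = e^{−π√28} < 1/2016`,
`E₆ = 1 − 504(x + ∑_{n≥2}σ₅(n)xⁿ)` and `0 ≤ ∑_{n≥2}σ₅(n)xⁿ ≤ 128x²/(1 − 8x) < x`, so
`E₆ > 1 − 1008x > 1/2`. [cite: Serre1973, VII §4.2 (E₆ = 1 − 504 Σ σ₅(n) qⁿ)] -/
theorem E₆_cmTau_neg_twentyeight_eq_ofReal :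
    ∃ r : ℝ, 1 / 2 < r ∧ (E₆ (cmTau (-28)) : ℂ) = (r : ℂ) := by
  have h := EisensteinSeries.q_expansion_bernoulli (by norm_num : 3 ≤ 6) (by decide) (cmTau (-28))
  have hb : bernoulli 6 = 1 / 42 := by
    rw [bernoulli_eq_bernoulli'_of_ne_one (by norm_num), PeriodPair.bernoulli'_six]
  simp_rw [zpow_natCast] at h
  rw [cexp_two_pi_I_cmTau_neg_twentyeight, hb] at h
  set x : ℝ := Real.exp (-(π * Real.sqrt 28)) with hxdef
  have hx0 : 0 < x := Real.exp_pos _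
  have hx : x < 1 / 2016 := exp_neg_pi_sqrt_twentyeight_lt
  have h8x : 8 * x < 1 := by linarith
  have h8x0 : 0 ≤ 8 * x := by linarith
  set S : ℝ := ∑' n : ℕ+, (σ 5 n : ℝ) * x ^ (n : ℕ) with hSdef
  refine ⟨1 - 504 * S, ?_, ?_⟩
  · suffices hS0 : S < 2 * x by linarith
    set g : ℕ → ℝ := fun m => (σ 5 (m + 1) : ℝ) * x ^ (m + 1) with hgdef
    have hS : S = ∑' m : ℕ, g m :=
      tsum_pnat_eq_tsum_succ (f := fun n : ℕ => (σ 5 n : ℝ) * x ^ n)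
    have hbound : ∀ m, ‖g m‖ ≤ 2 * (8 * x) ^ (m + 1) := by
      intro m
      rw [hgdef, Real.norm_eq_abs, abs_mul, abs_pow, abs_of_pos hx0, Nat.abs_cast]
      calc (σ 5 (m + 1) : ℝ) * x ^ (m + 1) ≤ 2 * 8 ^ (m + 1) * x ^ (m + 1) := by
            gcongr; exact sigma_five_le _
        _ = 2 * (8 * x) ^ (m + 1) := by rw [mul_pow]; ring
    have hgeom : Summable (fun m : ℕ => 2 * (8 * x) ^ (m + 1)) := by
      have := (summable_geometric_of_lt_one h8x0 h8x).mul_left (2 * (8 * x))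
      refine this.congr (fun m => ?_)
      ring
    have hsum : Summable g := Summable.of_norm_bounded hgeom hbound
    have hsplit := hsum.tsum_eq_zero_add
    have hg0 : g 0 = x := by
      simp [hgdef, ArithmeticFunction.sigma_apply, Nat.divisors_one]
    have htail_sum : Summable (fun m => g (m + 1)) := (summable_nat_add_iff 1).mpr hsum
    have hgeom2 : Summable (fun m : ℕ => 2 * (8 * x) ^ (m + 2)) := by
      have := (summable_geometric_of_lt_one h8x0 h8x).mul_left (2 * (8 * x) ^ 2)
      refine this.congr (fun m => ?_)
      ring
    have htail_le : ∑' m, g (m + 1) ≤ ∑' m : ℕ, 2 * (8 * x) ^ (m + 2) := by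
      refine Summable.tsum_le_tsum (fun m => ?_) htail_sum hgeom2
      exact (le_abs_self _).trans (by simpa [Real.norm_eq_abs] using hbound (m + 1))
    have hgeom_val : ∑' m : ℕ, 2 * (8 * x) ^ (m + 2) = 2 * (8 * x) ^ 2 / (1 - 8 * x) := by
      rw [show (fun m : ℕ => 2 * (8 * x) ^ (m + 2)) = fun m => (2 * (8 * x) ^ 2) * (8 * x) ^ m by
        funext m; ring]
      rw [tsum_mul_left, tsum_geometric_of_lt_one h8x0 h8x]
      field_simp
    have hSx : S = x + ∑' m, g (m + 1) := by rw [hS, hsplit, hg0]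
    rw [hSx]
    have h1 : 2 * (8 * x) ^ 2 / (1 - 8 * x) < x := by
      rw [div_lt_iff₀ (by linarith)]
      nlinarith
    linarith
  · rw [show (E₆ (cmTau (-28)) : ℂ) = E (by norm_num : 3 ≤ 6) (cmTau (-28)) from rfl, h,
      hSdef, Complex.ofReal_sub, Complex.ofReal_mul, Complex.ofReal_tsum]
    push_cast
    ring

end ModularForms

/-! ### The lattices `Λ₋₇`, `Λ₋₂₈`: `g₃ > 0`, `g₂ ≠ 0`, conjugation-stable -/

/-- **`g₃(Λ₋₇) > 0`** (real): `g₃(Λ₋₇) = (8π⁶/27)·E₆(ω₋₇)` (`PeriodPair.g₃_ofUpperHalfPlane`)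
with `E₆(ω₋₇) > 1`. [cite: SilvermanAEC2009, C.12 (g₃ = 140 G₆, Eisenstein series of Λ_τ)] -/
theorem g₃_cmPeriodPair_neg_seven_eq_ofReal :
    ∃ g : ℝ, 0 < g ∧ (cmPeriodPair (-7)).g₃ = (g : ℂ) := by
  obtain ⟨r, hr, hE⟩ := ModularForms.E₆_cmTau_neg_seven_eq_ofReal
  refine ⟨8 * π ^ 6 / 27 * r, by have : 0 < r := by linarith
                                 positivity, ?_⟩
  rw [cmPeriodPair, PeriodPair.g₃_ofUpperHalfPlane, hE]
  push_cast
  ring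

/-- **`g₃(Λ₋₂₈) > 0`** (real): `g₃(Λ₋₂₈) = (8π⁶/27)·E₆(ω₋₂₈)` with `E₆(ω₋₂₈) > 1/2`.
[cite: SilvermanAEC2009, C.12 (g₃ = 140 G₆, Eisenstein series of Λ_τ)] -/
theorem g₃_cmPeriodPair_neg_twentyeight_eq_ofReal :
    ∃ g : ℝ, 0 < g ∧ (cmPeriodPair (-28)).g₃ = (g : ℂ) := by
  obtain ⟨r, hr, hE⟩ := ModularForms.E₆_cmTau_neg_twentyeight_eq_ofReal
  refine ⟨8 * π ^ 6 / 27 * r, by have : 0 < r := by linarith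
                                 positivity, ?_⟩
  rw [cmPeriodPair, PeriodPair.g₃_ofUpperHalfPlane, hE]
  push_cast
  ring

/-- `g₂(Λ) ≠ 0` as soon as `j(Λ) ≠ 0` (`j = 1728 g₂³/(g₂³ − 27g₃²)`). [folklore] -/
private theorem g₂_ne_zero_of_j_ne_zero {L : PeriodPair} (h : L.j ≠ 0) : L.g₂ ≠ 0 := by
  intro h0
  apply h
  rw [PeriodPair.j_def, h0]
  simp

/-- `g₂(Λ₋₇) ≠ 0` (`j(Λ₋₇) = −3375 ≠ 0`). [cite: Cox2013, §12.C table (12.20), row d_K = −7] -/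
theorem g₂_cmPeriodPair_neg_seven_ne_zero : (cmPeriodPair (-7)).g₂ ≠ 0 :=
  g₂_ne_zero_of_j_ne_zero (by rw [j_cmPeriodPair_neg_seven]; norm_num)

/-- `g₂(Λ₋₂₈) ≠ 0` (`j(Λ₋₂₈) = 16581375 ≠ 0`). [cite: Cox2013, §12.C table (12.20), row D = −28] -/
theorem g₂_cmPeriodPair_neg_twentyeight_ne_zero : (cmPeriodPair (-28)).g₂ ≠ 0 :=
  g₂_ne_zero_of_j_ne_zero (by rw [j_cmPeriodPair_neg_twentyeight]; norm_num)

/-- **`Λ_d = ℤω_d + ℤ` is a real lattice** for `d < 0` (`ω̄_d = d − ω_d ∈ Λ_d`, `1̄ = 1`).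
[cite: Cox2013, §7.A eq. (7.1)] -/
theorem isReal_cmPeriodPair {d : ℤ} (hd : d < 0) : (cmPeriodPair d).IsReal := by
  refine PeriodPair.IsReal.of_conj_ω_mem ?_ ?_
  · rw [cmPeriodPair_ω₁ hd, conj_cmGen, PeriodPair.mem_lattice]
    refine ⟨-1, d, ?_⟩
    rw [cmPeriodPair_ω₁ hd, cmPeriodPair_ω₂]
    push_cast
    ring
  · rw [cmPeriodPair_ω₂, map_one]
    exact (cmPeriodPair d).ω₂_mem_lattice

/-! ### The lattice-type law: `Ω² ∈ ℝ` with the sign of `c₆` -/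

/-- **The lattice-type law.**  Let `W/ℚ` be a Weierstrass model of an elliptic curve whose Néron
lattice `L` (`IsNeronLatticeOf (W.baseChange ℂ) L`: `g₂(L) = c₄/12`, `g₃(L) = c₆/216`) is `Ω · Λ`
for a lattice `Λ` with `g₃(Λ) = g > 0` real and `g₂(Λ) ∈ ℝ ∖ {0}`.  Then `Ω² = t` is a NON-ZERO REAL
number and `t > 0 ↔ c₆(W) > 0`.  Proof: `u := Ω⁻¹` has `u⁴ = (c₄/12)/g₂(Λ) =: a ∈ ℝ` and
`u⁶ = (c₆/216)/g =: b ∈ ℝ ∖ {0}`, so `u² = b/a ∈ ℝ`, `Ω² = a/b`, and `(u²)³ = b` shows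
`sign(u²) = sign b = sign c₆`.  (The dichotomy «`Λ_E = Ω𝓞` with `Ω` real, or `Λ_E = iΩ'𝓞`» of a CM
curve over `ℚ` with class number one, decided by the sign of `c₆`; homogeneity `g₂(cΛ) = c⁻⁴g₂(Λ)`,
`g₃(cΛ) = c⁻⁶g₃(Λ)` of Silverman AEC Cor. VI.5.1.1, read for the CM lattice «𝔏 = Ω_∞𝒪» of
Coates–Li–Tian–Zhai §2.) [cite: SilvermanAEC2009, Cor. VI.5.1.1 (proof: g₂(cΛ) = c⁻⁴g₂, g₃(cΛ) = c⁻⁶g₃)]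
[cite: CoatesLiTianZhai2015, §2 (the period lattice 𝔏 = Ω_∞𝒪 of X₀(49))] -/
theorem exists_sq_eq_ofReal_of_lattice_eq_mulLeft {W : WeierstrassCurve ℚ} [W.IsElliptic]
    {L Λ : PeriodPair} (hL : ModularForms.IsNeronLatticeOf (W.baseChange ℂ) L) {Ω : ℂ} (hΩ : Ω ≠ 0)
    (hlat : L.lattice = (Λ.mulLeft Ω hΩ).lattice) {g : ℝ} (hg : 0 < g) (hg₃ : Λ.g₃ = (g : ℂ))
    (hg₂im : Λ.g₂.im = 0) (hg₂ : Λ.g₂ ≠ 0) :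
    ∃ t : ℝ, t ≠ 0 ∧ Ω ^ 2 = (t : ℂ) ∧ (0 < t ↔ 0 < W.c₆) := by
  -- `g₂(L) = Ω⁻⁴ g₂(Λ)`, `g₃(L) = Ω⁻⁶ g₃(Λ)`
  have hL₂ : L.g₂ = (Ω ^ 4)⁻¹ * Λ.g₂ := by
    rw [PeriodPair.g₂_eq_of_lattice_eq hlat, PeriodPair.g₂_mulLeft]
  have hL₃ : L.g₃ = (Ω ^ 6)⁻¹ * Λ.g₃ := by
    rw [PeriodPair.g₃_eq_of_lattice_eq hlat, PeriodPair.g₃_mulLeft]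
  have hc₄ : (W.baseChange ℂ).c₄ = ((W.c₄ : ℚ) : ℂ) := by
    simp only [WeierstrassCurve.baseChange, WeierstrassCurve.map_c₄, eq_ratCast]
  have hc₆ : (W.baseChange ℂ).c₆ = ((W.c₆ : ℚ) : ℂ) := by
    simp only [WeierstrassCurve.baseChange, WeierstrassCurve.map_c₆, eq_ratCast]
  -- the real numbers `a = u⁴`, `b = u⁶`, `u = Ω⁻¹`
  set g2 : ℝ := Λ.g₂.re with hg2def
  have hg2C : Λ.g₂ = (g2 : ℂ) := (Complex.ext (by simp [hg2def]) (by simp [hg2def, hg₂im]))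
  have hg2ne : g2 ≠ 0 := by
    intro h0; apply hg₂; rw [hg2C, h0, Complex.ofReal_zero]
  have hgne : g ≠ 0 := hg.ne'
  set a : ℝ := ((W.c₄ : ℝ) / 12) / g2 with hadef
  set b : ℝ := ((W.c₆ : ℝ) / 216) / g with hbdef
  have hu4 : (Ω⁻¹) ^ 4 = (a : ℂ) := by
    have h1 : L.g₂ = (W.c₄ : ℂ) / 12 := by rw [hL.1, hc₄]
    have h2 : (Ω ^ 4)⁻¹ * (g2 : ℂ) = (W.c₄ : ℂ) / 12 := by rw [← hg2C, ← hL₂, h1]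
    have hg2C0 : (g2 : ℂ) ≠ 0 := Complex.ofReal_ne_zero.mpr hg2ne
    rw [hadef, inv_pow]
    push_cast
    rw [← h2, mul_div_cancel_right₀ _ hg2C0]
  have hu6 : (Ω⁻¹) ^ 6 = (b : ℂ) := by
    have h1 : L.g₃ = (W.c₆ : ℂ) / 216 := by rw [hL.2, hc₆]
    have h2 : (Ω ^ 6)⁻¹ * (g : ℂ) = (W.c₆ : ℂ) / 216 := by rw [← hg₃, ← hL₃, h1]
    have hgC0 : (g : ℂ) ≠ 0 := Complex.ofReal_ne_zero.mpr hgne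
    rw [hbdef, inv_pow]
    push_cast
    rw [← h2, mul_div_cancel_right₀ _ hgC0]
  have hu0 : Ω⁻¹ ≠ 0 := inv_ne_zero hΩ
  have hb0 : b ≠ 0 := by
    intro h0
    rw [h0, Complex.ofReal_zero] at hu6
    exact pow_ne_zero 6 hu0 hu6
  have ha0 : a ≠ 0 := by
    intro h0
    rw [h0, Complex.ofReal_zero] at hu4
    exact pow_ne_zero 4 hu0 hu4
  -- `u² = b / a`
  have hu2 : (Ω⁻¹) ^ 2 = ((b / a : ℝ) : ℂ) := by
    have : (Ω⁻¹) ^ 2 * (Ω⁻¹) ^ 4 = (Ω⁻¹) ^ 6 := by ring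
    rw [hu4, hu6] at this
    have haC : (a : ℂ) ≠ 0 := Complex.ofReal_ne_zero.mpr ha0
    push_cast
    rw [eq_div_iff haC, this]
  refine ⟨a / b, div_ne_zero ha0 hb0, ?_, ?_⟩
  · have : Ω ^ 2 = ((Ω⁻¹) ^ 2)⁻¹ := by rw [inv_pow, inv_inv]
    rw [this, hu2]
    push_cast
    rw [inv_div]
  · -- `(b/a)³ = b`, so `sign (b/a) = sign b = sign c₆`
    have hcube : (b / a) ^ 3 = b := by
      have h : ((Ω⁻¹) ^ 2) ^ 3 = (Ω⁻¹) ^ 6 := by ring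
      rw [hu2, hu6] at h
      exact_mod_cast h
    have hsign : 0 < b / a ↔ 0 < b := by
      constructor
      · intro h; rw [← hcube]; positivity
      · intro h
        rcases le_or_gt (b / a) 0 with hle | hpos
        · have : (b / a) ^ 3 ≤ 0 := Odd.pow_nonpos (by decide : Odd 3) hle
          linarith
        · exact hpos
    have hab : 0 < a / b ↔ 0 < b / a := by
      rw [show a / b = (b / a)⁻¹ by rw [inv_div]]
      exact inv_pos
    rw [hab, hsign, hbdef]
    constructor
    · intro h
      have h216 : (0 : ℝ) < (W.c₆ : ℝ) / 216 := by
        rcases le_or_gt ((W.c₆ : ℝ) / 216) 0 with hle | hpos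
        · have : (W.c₆ : ℝ) / 216 / g ≤ 0 := div_nonpos_of_nonpos_of_nonneg hle hg.le
          linarith
        · exact hpos
      have : (0 : ℝ) < (W.c₆ : ℝ) := by linarith
      exact_mod_cast this
    · intro h
      have : (0 : ℝ) < (W.c₆ : ℝ) := by exact_mod_cast h
      positivity

/-! ### CM shape of the Néron lattice for `j = −3375` and `j = 255³`, and the generators' type -/

/-- **`j(W) = −3375 ⟹ Λ_W = Ω · Λ₋₇`** for every Néron lattice of the model `W/ℚ` (Cox, Thm. 10.9,
`PeriodPair.exists_lattice_eq_mulLeft_of_j_eq`, with the PROVED singular modulus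
`j(Λ₋₇) = −3375`, `j_cmPeriodPair_neg_seven`). [cite: Cox2013, Thm. 10.9 and §12.C table (12.20)] -/
theorem exists_lattice_eq_mulLeft_cmPeriodPair_of_j_eq_neg_3375 {W : WeierstrassCurve ℚ}
    [W.IsElliptic] {L : PeriodPair} (hL : ModularForms.IsNeronLatticeOf (W.baseChange ℂ) L)
    (hj : W.j = -3375) :
    ∃ (Ω : ℂ) (hΩ : Ω ≠ 0), L.lattice = ((cmPeriodPair (-7)).mulLeft Ω hΩ).lattice := by
  haveI : (W.baseChange ℂ).IsElliptic := by rw [WeierstrassCurve.baseChange]; infer_instance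
  have hjV : (W.baseChange ℂ).j = (W.j : ℂ) := by
    simp only [WeierstrassCurve.baseChange, WeierstrassCurve.map_j, eq_ratCast]
  have hjL : L.j = (W.j : ℂ) := by rw [PeriodPair.j_eq_weierstrassCurve_j hL.1 hL.2, hjV]
  have hJ : (cmPeriodPair (-7)).j = L.j := by rw [hjL, hj, j_cmPeriodPair_neg_seven]; norm_num
  exact PeriodPair.exists_lattice_eq_mulLeft_of_j_eq hJ

/-- **`j(W) = 16581375 = 255³ ⟹ Λ_W = Ω · Λ₋₂₈ = Ω · ℤ[√−7]`** for every Néron lattice of the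
model `W/ℚ` (Cox, Thm. 10.9 with the PROVED singular modulus `j(Λ₋₂₈) = 16581375`,
`j_cmPeriodPair_neg_twentyeight`). [cite: Cox2013, Thm. 10.9 and §12.C table (12.20), row D = −28] -/
theorem exists_lattice_eq_mulLeft_cmPeriodPair_of_j_eq_16581375 {W : WeierstrassCurve ℚ}
    [W.IsElliptic] {L : PeriodPair} (hL : ModularForms.IsNeronLatticeOf (W.baseChange ℂ) L)
    (hj : W.j = 16581375) :
    ∃ (Ω : ℂ) (hΩ : Ω ≠ 0), L.lattice = ((cmPeriodPair (-28)).mulLeft Ω hΩ).lattice := by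
  haveI : (W.baseChange ℂ).IsElliptic := by rw [WeierstrassCurve.baseChange]; infer_instance
  have hjV : (W.baseChange ℂ).j = (W.j : ℂ) := by
    simp only [WeierstrassCurve.baseChange, WeierstrassCurve.map_j, eq_ratCast]
  have hjL : L.j = (W.j : ℂ) := by rw [PeriodPair.j_eq_weierstrassCurve_j hL.1 hL.2, hjV]
  have hJ : (cmPeriodPair (-28)).j = L.j := by
    rw [hjL, hj, j_cmPeriodPair_neg_twentyeight]; norm_num
  exact PeriodPair.exists_lattice_eq_mulLeft_of_j_eq hJ

/-- **Type of the CM generator, `j = −3375`**: the Néron lattice of `W/ℚ` is `Ω · Λ₋₇` with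
`Ω² = t ∈ ℝ ∖ {0}` and `t > 0 ↔ c₆(W) > 0` (`Ω` real iff `c₆ > 0`, purely imaginary iff `c₆ < 0`;
e.g. `49a1`, `c₆ = 1323`: `Λ = Ω𝓞_K`, `Ω = 1.9333…` — «𝔏 = Ω_∞𝒪»).
[cite: CoatesLiTianZhai2015, §2 (the period lattice 𝔏 = Ω_∞𝒪 of X₀(49))] [cite: Cox2013, Thm. 10.9] -/
theorem exists_cm_generator_of_j_eq_neg_3375 {W : WeierstrassCurve ℚ} [W.IsElliptic]
    {L : PeriodPair} (hL : ModularForms.IsNeronLatticeOf (W.baseChange ℂ) L) (hj : W.j = -3375) :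
    ∃ (Ω : ℂ) (hΩ : Ω ≠ 0) (t : ℝ), L.lattice = ((cmPeriodPair (-7)).mulLeft Ω hΩ).lattice ∧
      t ≠ 0 ∧ Ω ^ 2 = (t : ℂ) ∧ (0 < t ↔ 0 < W.c₆) := by
  obtain ⟨Ω, hΩ, hlat⟩ := exists_lattice_eq_mulLeft_cmPeriodPair_of_j_eq_neg_3375 hL hj
  obtain ⟨g, hg, hg₃⟩ := g₃_cmPeriodPair_neg_seven_eq_ofReal
  obtain ⟨t, ht, hsq, hiff⟩ := exists_sq_eq_ofReal_of_lattice_eq_mulLeft hL hΩ hlat hg hg₃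
    ((isReal_cmPeriodPair (by norm_num)).g₂_im) g₂_cmPeriodPair_neg_seven_ne_zero
  exact ⟨Ω, hΩ, t, hlat, ht, hsq, hiff⟩

/-- **Type of the CM generator, `j = 255³`**: the Néron lattice of `W/ℚ` is `Ω · Λ₋₂₈` with
`Ω² = t ∈ ℝ ∖ {0}` and `t > 0 ↔ c₆(W) > 0`. [cite: Cox2013, Thm. 10.9 and §12.C table (12.20), row D = −28] -/
theorem exists_cm_generator_of_j_eq_16581375 {W : WeierstrassCurve ℚ} [W.IsElliptic]
    {L : PeriodPair} (hL : ModularForms.IsNeronLatticeOf (W.baseChange ℂ) L) (hj : W.j = 16581375) :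
    ∃ (Ω : ℂ) (hΩ : Ω ≠ 0) (t : ℝ), L.lattice = ((cmPeriodPair (-28)).mulLeft Ω hΩ).lattice ∧
      t ≠ 0 ∧ Ω ^ 2 = (t : ℂ) ∧ (0 < t ↔ 0 < W.c₆) := by
  obtain ⟨Ω, hΩ, hlat⟩ := exists_lattice_eq_mulLeft_cmPeriodPair_of_j_eq_16581375 hL hj
  obtain ⟨g, hg, hg₃⟩ := g₃_cmPeriodPair_neg_twentyeight_eq_ofReal
  obtain ⟨t, ht, hsq, hiff⟩ := exists_sq_eq_ofReal_of_lattice_eq_mulLeft hL hΩ hlat hg hg₃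
    ((isReal_cmPeriodPair (by norm_num)).g₂_im) g₂_cmPeriodPair_neg_twentyeight_ne_zero
  exact ⟨Ω, hΩ, t, hlat, ht, hsq, hiff⟩

end Literature.NumberTheory.EllipticCurves

end
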